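import Literature.AlgebraicGeometry.Frobenioids.PadicFrobenioidPerfection
import Literature.AlgebraicGeometry.Frobenioids.PadicFrobenioidZeroMonoid
import Literature.AlgebraicGeometry.Frobenioids.PadicFrobenioidRmk122
import HarnessLib

/-!
# Frobenioids II, Example 1.1 (i)/(ii): the pull-back maps of `Φ₀ = ord(O^⊳) ⊗ ℝ_{≥0}` and of `ord(O^⊳)^pf` are bijective

Mochizuki, *The geometry of Frobenioids II*, Kyushu J. Math. **62** (2008) 401–460, §1, Example 1.1 (i), p. 7:
"`Φ₀ : Spec(K) ↦ ord(O_K^⊳)^rlf` … determines a monoid on `D₀` … [which satisfies `Φ₀^birat = Φ₀^gp`]"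
[cite: MochizukiFrdII2008, Ex 1.1 (i) p.7]; along `Spec(K) → Spec(L)` the restriction map
`ord(O_L^⊳) ⊗ ℝ_{≥0} → ord(O_K^⊳) ⊗ ℝ_{≥0}` is multiplication by the ramification index on `ℝ_{≥0}`, a bijection.

* `Realification.map_surjective_of_isZMonoprime`, **`Realification.map_bijective_of_isZMonoprime`** — for an
  injective homomorphism `φ : M → N` of `ℤ`-monoprime monoids, `φ ⊗ ℝ_{≥0} : M ⊗ ℝ_{≥0} → N ⊗ ℝ_{≥0}` is bijective
  (abc-iut-found's double-dual `Realification`; injectivity is abc-iut-L1-d8's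
  `Realification.map_injective_of_isZMonoprime`; surjectivity: `Hom(N, ℝ_{≥0}) → Hom(M, ℝ_{≥0})`, `g ↦ g ∘ φ`, is
  multiplication by `deg φ(gen) ≠ 0` on `ℝ_{≥0}`, inverted by `Realification.pushDual`);
* `PadicFrd.phi0Map_bijective` — all pull-back maps of `Φ₀|_D` over a base of `p`-adic local fields are bijective;
  `Datum.zero_hasBijectivePullbacks`; `Realification.perf_map_bijective` / `Datum.perf_hasBijectivePullbacks` —
  likewise for the perfection `ord(O^⊳)^pf` ([IUTchI] Ex. 3.3 (i) `Φ_{C_v}`): the constancy hypothesis of the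
  repaired reading (R1) of Rmk. 1.2.2 holds for `C₀|_D` and `C_v` over every base.
-/

noncomputable section

namespace Literature.AlgebraicGeometry.Frobenioids

open Function
open scoped NNReal

universe u

namespace Realification

section ZMonoprime

variable {M N : Type u} [CommMonoid M] [CommMonoid N] (eM : M ≃* Multiplicative ℕ) (eN : N ≃* Multiplicative ℕ)
  (φ : M →* N)

/-- `deg(1) = 0`. [cite: MochizukiFrdI2008, §0 p.10] -/
theorem zdeg_one : zdeg eN (1 : N) = 0 := by rw [zdeg, map_one, toAdd_one]

/-- `deg(a b) = deg(a) + deg(b)`. [cite: MochizukiFrdI2008, §0 p.10] -/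
theorem zdeg_mul (a b : N) : zdeg eN (a * b) = zdeg eN a + zdeg eN b := by rw [zdeg, map_mul, toAdd_mul]; rfl

/-- A homomorphism `g : N → ℝ_{≥0}` out of `N ≅ ℤ_{≥0}` is `n ↦ deg(n) · g(gen)`. [cite: MochizukiFrdI2008, §0 p.10] -/
theorem toAdd_rDual_apply (g : RDual N) (n : N) :
    Multiplicative.toAdd (g n) = (zdeg eN n : ℝ≥0) * Multiplicative.toAdd (g (zgen eN)) := by
  conv_lhs => rw [eq_zgen_pow eN n]
  rw [map_pow, toAdd_pow, nsmul_eq_mul]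

/-- The degree `k` of `φ(gen_M) = gen_N^k`. [cite: MochizukiFrdI2008, §0 p.10] -/
def mapDeg : ℕ := zdeg eN (φ (zgen eM))

variable {φ} in
/-- `k ≠ 0` for injective `φ`. [cite: MochizukiFrdI2008, §0 p.10] -/
theorem mapDeg_ne_zero (hφ : Injective φ) : mapDeg eM eN φ ≠ 0 := by
  intro h
  have h1 : φ (zgen eM) = 1 := by rw [eq_zgen_pow eN (φ (zgen eM)), show zdeg eN (φ (zgen eM)) = 0 from h, pow_zero]
  have h2 : zgen eM = 1 := hφ (h1.trans (map_one φ).symm)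
  have h3 : eM (zgen eM) = 1 := by rw [h2, map_one]
  rw [zgen, MulEquiv.apply_symm_apply] at h3
  exact one_ne_zero (Multiplicative.ofAdd.injective (h3.trans ofAdd_zero.symm))

/-- The homomorphism `N → ℝ_{≥0}` with prescribed value `c` (additively) at the generator: `n ↦ deg(n) · c`.
[cite: MochizukiFrdI2008, §0 p.10] -/
def rDualOfValue (c : ℝ≥0) : RDual N where
  toFun n := Multiplicative.ofAdd ((zdeg eN n : ℝ≥0) * c)
  map_one' := by rw [zdeg_one, Nat.cast_zero, zero_mul]; rfl
  map_mul' a b := by rw [zdeg_mul, Nat.cast_add, add_mul, ofAdd_add]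

/-- Its value at `n`. [cite: MochizukiFrdI2008, §0 p.10] -/
@[simp] theorem toAdd_rDualOfValue_apply (c : ℝ≥0) (n : N) :
    Multiplicative.toAdd (rDualOfValue eN c n) = (zdeg eN n : ℝ≥0) * c := rfl

/-- **The inverse transpose** `Hom(M, ℝ_{≥0}) → Hom(N, ℝ_{≥0})`: `g' ↦ (n ↦ deg(n) · g'(gen_M) / k)`, a
homomorphism inverting `g ↦ g ∘ φ`. [cite: MochizukiFrdI2008, §0 p.10] -/
def pushDual : RDual M →* RDual N where
  toFun g' := rDualOfValue eN (Multiplicative.toAdd (g' (zgen eM)) / (mapDeg eM eN φ : ℝ≥0))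
  map_one' := by
    refine MonoidHom.ext fun n => Multiplicative.toAdd.injective ?_
    simp only [toAdd_rDualOfValue_apply, MonoidHom.one_apply, toAdd_one, zero_div, mul_zero]
  map_mul' a b := by
    refine MonoidHom.ext fun n => Multiplicative.toAdd.injective ?_
    simp only [MonoidHom.mul_apply, toAdd_mul, toAdd_rDualOfValue_apply, add_div, mul_add]

variable {φ} in
/-- `pushDual (g ∘ φ) = g`: precomposition with `φ` is inverted. [cite: MochizukiFrdI2008, §0 p.10] -/
theorem pushDual_comp (hφ : Injective φ) (g : RDual N) : pushDual eM eN φ (g.comp φ) = g := by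
  refine MonoidHom.ext fun n => Multiplicative.toAdd.injective ?_
  have hk : ((mapDeg eM eN φ : ℕ) : ℝ≥0) ≠ 0 := Nat.cast_ne_zero.mpr (mapDeg_ne_zero eM eN hφ)
  change Multiplicative.toAdd (rDualOfValue eN _ n) = _
  rw [toAdd_rDualOfValue_apply, MonoidHom.comp_apply, toAdd_rDual_apply eN g (φ (zgen eM)),
    toAdd_rDual_apply eN g n]
  congr 1
  exact mul_div_cancel_left₀ _ hk

/-- `(φ ⊗ ℝ_{≥0})(x)(g) = x(g ∘ φ)`. [cite: MochizukiFrdI2008, §0 p.10] -/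
theorem map_apply (x : Realification M) (g : RDual N) :
    (show RDual N →* Multiplicative ℝ≥0 from Realification.map φ x) g =
      (show RDual M →* Multiplicative ℝ≥0 from x) (g.comp φ) := rfl

variable {φ} in
include eM eN in
/-- `φ ⊗ ℝ_{≥0}` is surjective for injective `φ` between `ℤ`-monoprime monoids: `y ↦ y ∘ pushDual` is a section.
[cite: MochizukiFrdI2008, §0 p.10] -/
theorem map_surjective_of_equiv (hφ : Injective φ) : Surjective (Realification.map φ) := by
  intro y
  refine ⟨(show RDual (RDual N) from y).comp (pushDual eM eN φ), ?_⟩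
  refine MonoidHom.ext fun g => ?_
  rw [map_apply]
  change (show RDual (RDual N) from y) (pushDual eM eN φ (g.comp φ)) = (show RDual (RDual N) from y) g
  rw [pushDual_comp eM eN hφ]

end ZMonoprime

/-- **`φ ⊗ ℝ_{≥0}` is surjective** for an injective homomorphism of `ℤ`-monoprime monoids.
[cite: MochizukiFrdI2008, §0 p.10] -/
theorem map_surjective_of_isZMonoprime {M N : Type u} [CommMonoid M] [CommMonoid N] (hM : IsZMonoprime M)
    (hN : IsZMonoprime N) (φ : M →* N) (hφ : Injective φ) : Surjective (Realification.map φ) := by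
  obtain ⟨⟨eM⟩⟩ := hM
  obtain ⟨⟨eN⟩⟩ := hN
  exact map_surjective_of_equiv eM eN hφ

/-- **`φ ⊗ ℝ_{≥0}` is bijective** for an injective homomorphism of `ℤ`-monoprime monoids (on `ℝ_{≥0}` it is
multiplication by `deg φ(gen) ≠ 0`). [cite: MochizukiFrdI2008, §0 p.10] -/
theorem map_bijective_of_isZMonoprime {M N : Type u} [CommMonoid M] [CommMonoid N] (hM : IsZMonoprime M)
    (hN : IsZMonoprime N) (φ : M →* N) (hφ : Injective φ) : Bijective (Realification.map φ) :=
  ⟨map_injective_of_isZMonoprime hM hN φ hφ, map_surjective_of_isZMonoprime hM hN φ hφ⟩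

/-- **The perfections**: `φ ⊗ ℝ_{≥0}` restricts to a bijection `M^pf → N^pf` for injective `φ` between
`ℤ`-monoprime monoids (surjectivity: if `y^n = m' ⊗ 1` then `y^{nk} = φ(m) ⊗ 1` with `m'^k = φ(m)`, so the
preimage of `y` lies in `M^pf`). [cite: MochizukiFrdI2008, §0 p.10] -/
theorem perf_map_bijective {M N : Type u} [CommMonoid M] [CommMonoid N] (hM : IsZMonoprime M)
    (hN : IsZMonoprime N) (φ : M →* N) (hφ : Injective φ) :
    Bijective (((Realification.map φ).restrict (perf M)).codRestrict (perf N) fun x => map_mem_perf φ x.2) := by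
  obtain ⟨⟨eM⟩⟩ := id hM
  obtain ⟨⟨eN⟩⟩ := id hN
  have hbij := map_bijective_of_isZMonoprime hM hN φ hφ
  constructor
  · intro x y h
    exact Subtype.ext (hbij.1 (congrArg Subtype.val h))
  · rintro ⟨y, n, hn, m', hm'⟩
    obtain ⟨x, hx⟩ := hbij.2 y
    -- `m'^k = φ(gen_M^{deg m'})` with `k = deg φ(gen_M)`
    have hk : m' ^ mapDeg eM eN φ = φ (zgen eM ^ zdeg eN m') := by
      apply eN.injective
      apply Multiplicative.toAdd.injective
      rw [map_pow eN m', map_pow φ, map_pow eN (φ (zgen eM)), toAdd_pow, toAdd_pow, smul_eq_mul, smul_eq_mul]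
      exact Nat.mul_comm _ _
    refine ⟨⟨x, n * mapDeg eM eN φ, Nat.mul_pos hn (Nat.pos_of_ne_zero (mapDeg_ne_zero eM eN hφ)),
      zgen eM ^ zdeg eN m', hbij.1 ?_⟩, Subtype.ext hx⟩
    rw [Realification.map_of, map_pow (Realification.map φ), hx, pow_mul, ← hm', ← map_pow, hk]

end Realification

/-! ### The pull-back maps of `Φ₀|_D` and of the perfection datum -/

namespace PadicFrd

open CategoryTheory Opposite

universe v

variable {D : Type u} [Category.{v} D] {p : ℕ} [Fact p.Prime] (base : D ⥤ PadicFld.{u} p)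

/-- **All pull-back maps of `Φ₀|_D = ord(O^⊳) ⊗ ℝ_{≥0}` are bijective** over a base of `p`-adic local fields
(`ord(O_{K'}^⊳) → ord(O_K^⊳)` is injective between `ℤ`-monoprime monoids, abc-iut-L1-d10/d8).
[cite: MochizukiFrdII2008, Ex 1.1 (i) p.7] -/
theorem phi0Map_bijective (hloc : ∀ A : D, (base.obj A).IsPadicLocal) {A A' : Dᵒᵖ} (f : A ⟶ A') :
    Bijective (phi0Map base f) := by
  obtain ⟨⟨instA, hfinA, hcA⟩⟩ := hloc A.unop
  obtain ⟨⟨instA', hfinA', hcA'⟩⟩ := hloc A'.unop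
  have hZ : IsZMonoprime (OrdInt (base.obj A.unop).K) := by
    letI := instA; haveI := hfinA; exact isZMonoprime_ordInt hcA
  have hZ' : IsZMonoprime (OrdInt (base.obj A'.unop).K) := by
    letI := instA'; haveI := hfinA'; exact isZMonoprime_ordInt hcA'
  exact Realification.map_bijective_of_isZMonoprime hZ hZ' _ (ordIntMapOfHom_injective _ _)

/-- Hence `Datum.zero` (the datum of `C₀|_D`, `Φ = Φ₀|_D`) has bijective pull-backs over every base: the
constancy hypothesis of reading (R1) of Rmk. 1.2.2 holds for it. [cite: MochizukiFrdII2008, Ex 1.1 (ii) p.8] -/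
theorem Datum.zero_hasBijectivePullbacks (hloc : ∀ A : D, (base.obj A).IsPadicLocal) (hc : IsConnected D)
    (he : IsTotallyEpimorphic D) (hmono : ∀ A : D, IsMonoprime (OrdInt (base.obj A).K)) :
    (Datum.zero base hloc hc he hmono).HasBijectivePullbacks :=
  fun f => phi0Map_bijective base hloc f.op

/-- **All pull-back maps of the perfection `ord(O^⊳)^pf` are bijective** (`Datum.perf`, [IUTchI] Ex. 3.3 (i)
`Φ_{C_v}`), over every base of `p`-adic local fields. [cite: MochizukiFrdII2008, Ex 1.1 (ii) p.8] -/
theorem Datum.perf_hasBijectivePullbacks (hloc : ∀ A : D, (base.obj A).IsPadicLocal) (hc : IsConnected D)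
    (he : IsTotallyEpimorphic D) :
    (Datum.perf base hloc hc he).HasBijectivePullbacks := by
  intro A A' f
  obtain ⟨⟨instA, hfinA, hcA⟩⟩ := hloc A
  obtain ⟨⟨instA', hfinA', hcA'⟩⟩ := hloc A'
  have hZ : IsZMonoprime (OrdInt (base.obj A').K) := by
    letI := instA'; haveI := hfinA'; exact isZMonoprime_ordInt hcA'
  have hZ' : IsZMonoprime (OrdInt (base.obj A).K) := by
    letI := instA; haveI := hfinA; exact isZMonoprime_ordInt hcA
  exact Realification.perf_map_bijective hZ hZ' _ (ordIntMapOfHom_injective _ _)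

end PadicFrd

end Literature.AlgebraicGeometry.Frobenioids
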